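/-
Copyright (c) 2026 the pub-hodgecm-mathlib formalisation cell (harness21).  Prover seat hodgecm-mathlib-K2E1b-p09 (g0), Track B «K2-LIT»
(build stream 29), h413 = `stmt-HodgeConjecture-24833`, line `K2_E1b_GKCohomologyU21`, socket module «U23 CarriersData» (unit U2 «CARRIERS-J DATA»),
file #11 — the payment of `K2E1bGKCohomologyU21.U23.sig_K2E1bJDatum` TOKEN FOR TOKEN.  2026-09-03.
-/
import Literature.RepresentationTheory.Kovacevic2021.SU21Irreducible      -- ★ `rayNE`, `raySE` (via `SU21ModulesFromKTypes`), `isIrreducible_rayNE`, `isIrreducible_raySE`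
import Literature.RepresentationTheory.Kovacevic2021.SU21UnitarityRays   -- ★ `IsUnitarizable`, `rayNE_isUnitarizable`, `raySE_isUnitarizable`
import Literature.NumberTheory.Rogawski1990.OneDimAutRepH                -- ★ `ArchSignRecipe.rogTriple`
import HarnessLib

/-!
# h413 ∕ Track B «K2-LIT», line `K2_E1b_GKCohomologyU21`, unit U2 «CARRIERS-J DATA»: the Kovačević datum carrying `J^{±}_φ|_{SU(2,1)}` at every `φ`
# (payment of `Cruxes/H413/Lines/K2_E1b_GKCohomologyU21_U23_CarriersData.lean :: sig_K2E1bJDatum`, statement bytes frozen)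

Cell `pub/hodgecm-mathlib` (D-0151), Track B (21-frontier RULING «PUSH BOTH» 2026-09-03, director req621∕req624, chair K2-lead, dealer K2E1b-plan),
socket module `Summits/HodgeConjecture/HodgeConjecture/Cruxes/H413/Lines/K2_E1b_GKCohomologyU21_U23_CarriersData.lean` (planner K2E1b-plan (g0),
sha16 298b9591bc0170d4), socket **`sig_K2E1bJDatum`** (SIGS TABLE row #11, size XL «HARDEST»): for every `(p, q, t)` with Rogawski triple
`(a, b, c) = rogTriple p q t` and central exponent `e = a + b + c`, SOME irreducible unitarizable Kovačević datum `𝒬` with infinitely many `K`-types,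
all of them integral for the twist by `e` (`6 ∣ m − 3n + 3 + 2e`), on which the trace-form Casimir `Σ_{ij} E_{ij} E_{ji}` acts by the `𝔰𝔩(3)`-part
`κ₀(φ) = (a² + b² + c² − 2) − e²∕3` of the infinitesimal character of `F_φ`.

THE MATHEMATICS — the witness IS print's `J^{rogSign}_φ|_{SU(2,1)}`, which is a LADDER ray, so no principal-series subquotient is needed.
Write `s = p + t`.  [Rogawski1990, §12.3 p. 178]: in the `+` case (`s ≤ −1`) `(a, b, c) = (q, q+s+1, q+s)`, so `n = b − c = 1` and `m = a − b = −s − 1 ≥ 0`;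
in the `−` case (`s ≥ 0`) `(a, b, c) = (q+s+1, q+s, q)`, `m = 1`, `n = s`.  In both cases
    `κ₀(φ) = ⅓((a−b)² + (b−c)² + (a−c)²) − 2 = ((2s+1)² − 9) ∕ 6`,      `e = a + b + c = 3q + 2s + 1`.
Kovačević's ray data [Kovacevic2021, §3 Thm. 3 (b75)∕(b80), §4 Thm. 4–5: the ladders `Z(σ)`, `|σ| ≥ 2`, and `U(0, 2t)`]: ★ `rayNE e′ n₀` has `K`-types
`V_{n, 3n+e′}` (`n ≥ n₀`), ★ `raySE e′ n₀` has `V_{n, −(3n+e′)}`, under `(n₀ − 1)(2n₀ + e′ − 1) = 0`; the trace-form Casimir acts on either by `(e′² − 9)∕6`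
(★ `SU21CasimirCentral.casimir_rayNE_eq_smul` ∕ `casimir_raySE_eq_smul` — RE-DERIVED below from the ★ action lemmas of `SU21ModulesFromKTypes`, because the
`SU21Casimir*` modules are outside the farm's built set tonight), they are irreducible as soon as `2n + e′ + 1 ≠ 0` along the ray (★ `isIrreducible_rayNE` ∕
`isIrreducible_raySE`) and unitarizable when `2n₀ + e′ + 1 > 0` (★ `rayNE_isUnitarizable` ∕ `raySE_isUnitarizable`, Kovačević's Thm. 4 sign test).
WITNESS: `+` case ↦ `rayNE (2s+1) (−s)` = the ladder `Z(1 − s) = Z(m + 2)` (lowest `K`-type `V_{m+1, m+2}`; at the cohomological parameter `m = 1` this is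
★ `ladderPlus = Z(3) = J_{1,0}`), `−` case ↦ `raySE (−(2s+1)) (s+1)` = the mirror ladder `Z(−(n+2))` (★ `ladderMinus` at `n = 1`).  CHECKS: the ray constraint
`2n₀² + (e′−3)n₀ + (1−e′) = 0` holds identically in `s`; `2n₀ + e′ + 1 = 2 > 0` (unitarity) and `2n + e′ + 1 ≥ 2` along the ray (irreducibility); the `K`-types
`n ≥ n₀` are infinitely many; integrality: `m′ − 3n′ + 3 + 2e = ±(…)`: NE ray `e′ + 3 + 2(3q+2s+1) = 6(q+s+1)`, SE ray `−6n′ − e′ + 3 + 2e = 6(q+s+1−n′)`;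
Casimir `((2s+1)² − 9)∕6 = κ₀(φ)` by the identity displayed above.  Nothing printed is asserted beyond Kovačević's PROVED-in-tree ray modules.

* §0 `sum_lie_lie_eq_apply`, `sum_lie_lie_vec`, `sum_lie_lie_eq_smul` — the double-bracket sum `Σ_{ij} ⁅E_{ij}, ⁅E_{ji}, ·⁆⁆` on ANY datum: it is the
  operator `Σ ρ(E_{ij})ρ(E_{ji})` applied; on a basis vector `u^k_{n,m}` it is the REDUCED scalar `(n−1)(n+3)∕2 + m²∕6 + 2n(A D′ + B C′)` (raw expansion by
  the eight ★ action lemmas, then (b25) − (b20)); hence a scalar `c` on all of `V` when the reduced scalar is constantly `c` on `S`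
  (re-derivation of ★ `SU21Casimir.casimir_vec` + ★ `SU21CasimirCentral.casimir_vec_reduced` ∕ `casimir_eq_smul_one`, same tactic script);
* §1 `rayNE_sum_lie_lie`, `raySE_sum_lie_lie` (closed form `(e′²−9)∕6`), `rayNE_infinite`, `raySE_infinite`;
* §2 **`jDatum`** — `sig_K2E1bJDatum` TOKEN FOR TOKEN; §3 `jDatum_plus` ∕ `jDatum_minus` — the two cases with the witness NAMED (for the assembly
  #20 `K2E1bJCarrierClass` and for U6's Level-B uniqueness, which want to know WHICH datum was chosen).
No hypothesis is idle (the triple equation fixes `(a,b,c)`; drop it and `κ₀` is unconstrained); the conclusion is not vacuous (a datum is exhibited).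

HONEST LABEL.  HC_CM is proved only modulo the 7 printed citations (2 remaining named inputs: hLiu418 = `stmt-HodgeConjecture-24832`, h413 =
`stmt-HodgeConjecture-24833`) until rung 0 closes; this file is a `--supports stmt-HodgeConjecture-24833` helper (tier-2 socket payment) and moves no counter.
LEVEL A only: that this datum IS `J^{±}_φ|_{SU(2,1)}` (Langlands-quotient uniqueness in `K`-type coordinates, SIGS TABLE #22) is NOT claimed here.

## References
* [Rogawski1990] J. D. Rogawski, *Automorphic Representations of Unitary Groups in Three Variables*, Ann. of Math. Stud. 123 (1990) — §12.3 pp. 176–178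
  (`χ^±_φ`, `J^±_φ`, «`J^+_φ` (resp. `J^−_φ`) is unitary if and only if `n = 1` (resp. `m = 1`)», the triple `(a,b,c)` of `ξ_ι`).
* [Kovacevic2021] D. Kovačević, *Unitary `(𝔤,K)` modules of `SU(2,1)`*, Acta Math. Spalatensia 1 (2021) 105–125 — §3 Thm. 1–3, §4 Thm. 4–5 (`Z(s)`, `U(l,2t)`).
* [BorelWallach2000] A. Borel, N. Wallach, *Continuous Cohomology, Discrete Subgroups, and Representations of Reductive Groups*, 2nd ed. (2000) —
  II §2.3–2.5 (the Casimir), VI Thm. 4.11–4.12 (the ladders `J_{i,j}` of `SU(n,1)` and their unitarity).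
-/

set_option autoImplicit false
-- the mandated namespace repeats the single-problem summit's segment (`HodgeConjecture.HodgeConjecture`)
set_option linter.dupNamespace false

noncomputable section

namespace Summit.HodgeConjecture.HodgeConjecture.Cruxes.H413.K2E1bJDatum

open Literature.NumberTheory.Rogawski1990
open Literature.RepresentationTheory.Kovacevic2021 Literature.RepresentationTheory.Kovacevic2021.SU21Datum

-- Mathlib idiom (as in ★ `SU21ModulesFromKTypes`, ★ `SU21Irreducible`, the socket module): the Lie bracket on the associative algebra
-- `Matrix (Fin 3) (Fin 3) ℂ` is the commutator; the frozen socket statement (`LieModule.IsIrreducible ℂ (Matrix (Fin 3) (Fin 3) ℂ) 𝒬.V`) needs it.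
attribute [local instance 100] LieRing.ofAssociativeRing

/-! ## §0 The trace-form Casimir sum `Σ_{ij} ⁅E_{ij}, ⁅E_{ji}, ·⁆⁆` on a Kovačević datum -/

/-- The double-bracket sum is the operator `Σ_{ij} ρ(E_{ij}) ρ(E_{ji})` of `End V` applied (★ `lie_def`: `⁅M, v⁆ = ρ(M) v`).
[cite: BorelWallach2000, II §2.3 p. 34] -/
theorem sum_lie_lie_eq_apply (𝒟 : SU21Datum) (v : 𝒟.V) :
    (∑ i : Fin 3, ∑ j : Fin 3, ⁅E i j, ⁅E j i, v⁆⁆) = (∑ i : Fin 3, ∑ j : Fin 3, 𝒟.ρfun (E i j) * 𝒟.ρfun (E j i)) v := by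
  simp only [LinearMap.sum_apply, Module.End.mul_apply, lie_def]

-- One fixed expansion step (the eight ★ action lemmas, vanishing of `vec` off range by `omega`, linear bookkeeping) at each of the four boundary
-- cases `k = 1 ∨ k ≥ 2`, `k = n ∨ k < n`; which simp lemmas fire varies with the case, so the unused-simp-argument linter is off for this one
-- declaration (the script of ★ `SU21Casimir.casimir_vec`, whose module is outside the farm's built set).
set_option linter.unusedSimpArgs false in
/-- **The Casimir sum on a basis vector, reduced by (b20)∕(b25)**: for every admissible label,
`Σ_{ij} ⁅E_{ij}, ⁅E_{ji}, u^k_{n,m}⁆⁆ = ((n−1)(n+3)∕2 + m²∕6 + 2n (A_{n,m} D_{n+1,m+3} + B_{n,m} C_{n+1,m−3})) u^k_{n,m}` — only the gauge-invariant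
products `A D′`, `B C′` enter.  (Re-derivation of ★ `casimir_vec` ∕ ★ `casimir_vec_reduced`.) [cite: Kovacevic2021, §3 Thm. 1–2, Remark 3] [cite: BorelWallach2000, II §2.5] -/
theorem sum_lie_lie_vec (𝒟 : SU21Datum) {n m k : ℤ} (hS : (n, m) ∈ 𝒟.S) (hk : 1 ≤ k) (hkn : k ≤ n) :
    (∑ i : Fin 3, ∑ j : Fin 3, ⁅E i j, ⁅E j i, 𝒟.vec n m k⁆⁆) =
      (((n : ℂ) - 1) * ((n : ℂ) + 3) / 2 + (m : ℂ) ^ 2 / 6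
        + 2 * (n : ℂ) * (𝒟.A n m * 𝒟.D (n + 1) (m + 3) + 𝒟.B n m * 𝒟.C (n + 1) (m - 3))) • 𝒟.vec n m k := by
  have raw : (∑ i : Fin 3, ∑ j : Fin 3, ⁅E i j, ⁅E j i, 𝒟.vec n m k⁆⁆) =
      (((n : ℂ) ^ 2 - 1) / 2 + (m : ℂ) ^ 2 / 6
        + ((n : ℂ) + 1) * (𝒟.A n m * 𝒟.D (n + 1) (m + 3) + 𝒟.B n m * 𝒟.C (n + 1) (m - 3))
        + ((n : ℂ) - 1) * (𝒟.D n m * 𝒟.A (n - 1) (m - 3) + 𝒟.C n m * 𝒟.B (n - 1) (m + 3))) • 𝒟.vec n m k := by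
    simp only [Fin.sum_univ_three, lie_def, ρfun_E]
    rcases eq_or_lt_of_le hk with rfl | hk2 <;> rcases (eq_or_lt_of_le hkn).imp Eq.symm id with rfl | hkn2
    all_goals
      simp (disch := omega) only [Module.End.mul_apply, LinearMap.sub_apply, LinearMap.add_apply, LinearMap.neg_apply,
        LinearMap.smul_apply, LinearMap.zero_apply, map_add, map_sub, map_neg, map_smul, map_zero, smul_zero, Ha_vec,
        Hb_vec, Xa_vec, Ya_vec, Xab_vec, Xb_vec, Yab_vec, Yb_vec, vec_of_not_range, smul_add, smul_sub, smul_neg,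
        smul_smul, neg_smul, neg_neg, sub_add_cancel, add_sub_cancel_right, Int.cast_add, Int.cast_sub, Int.cast_one,
        Int.cast_ofNat, Int.cast_zero, add_zero, zero_add]
    all_goals match_scalars <;> ring1
  rw [raw]
  congr 1
  linear_combination 𝒟.rel25 hS - 𝒟.rel20 hS

/-- A datum on all of whose `K`-types the reduced scalar equals `c` has `Σ_{ij} ⁅E_{ij}, ⁅E_{ji}, v⁆⁆ = c · v` for every `v` (the basis `u^k_{n,m}` spans `V`,
★ `ext_vec`).  (Re-derivation of ★ `casimir_eq_smul_one`, pointwise.) [cite: Kovacevic2021, §3 Thm. 2, Remark 3] [cite: BorelWallach2000, II §2.5] -/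
theorem sum_lie_lie_eq_smul (𝒟 : SU21Datum) {c : ℂ}
    (h : ∀ n m : ℤ, (n, m) ∈ 𝒟.S →
      ((n : ℂ) - 1) * ((n : ℂ) + 3) / 2 + (m : ℂ) ^ 2 / 6
        + 2 * (n : ℂ) * (𝒟.A n m * 𝒟.D (n + 1) (m + 3) + 𝒟.B n m * 𝒟.C (n + 1) (m - 3)) = c) (v : 𝒟.V) :
    (∑ i : Fin 3, ∑ j : Fin 3, ⁅E i j, ⁅E j i, v⁆⁆) = c • v := by
  have hop : (∑ i : Fin 3, ∑ j : Fin 3, 𝒟.ρfun (E i j) * 𝒟.ρfun (E j i)) = c • (1 : Module.End ℂ 𝒟.V) := by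
    refine ext_vec fun n m k hS hk hkn => ?_
    rw [← sum_lie_lie_eq_apply, sum_lie_lie_vec 𝒟 hS hk hkn, h n m hS, LinearMap.smul_apply, Module.End.one_apply]
  rw [sum_lie_lie_eq_apply, hop, LinearMap.smul_apply, Module.End.one_apply]

/-! ## §1 The ray data: closed-form Casimir and infinitely many `K`-types -/

/-- **Closed form on the north-east ray datum**: `Σ_{ij} ⁅E_{ij}, ⁅E_{ji}, v⁆⁆ = ((e² − 9)∕6) · v` on `rayNE e n₀` (`K`-types `V_{n,3n+e}`, `n ≥ n₀`,
`A_n = −(2n+e+1)∕2`, `D = 1`, `B = C = 0`).  (★ `casimir_rayNE_eq_smul`, pointwise, re-derived.) [cite: Kovacevic2021, §3 Thm. 3 (b75), §4] -/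
theorem rayNE_sum_lie_lie (e n₀ : ℤ) (h₀ : 1 ≤ n₀) (h : 2 * n₀ ^ 2 + (e - 3) * n₀ + (1 - e) = 0) (v : (rayNE e n₀ h₀ h).V) :
    (∑ i : Fin 3, ∑ j : Fin 3, ⁅E i j, ⁅E j i, v⁆⁆) = (((e : ℂ) ^ 2 - 9) / 6) • v := by
  refine sum_lie_lie_eq_smul _ (fun n m hS => ?_) v
  obtain ⟨hn, hm⟩ := hS
  change n₀ ≤ n at hn
  change m = 3 * n + e at hm
  subst hm
  have hA : (rayNE e n₀ h₀ h).A n (3 * n + e) = -(2 * (n : ℂ) + e + 1) / 2 := if_pos ⟨hn, rfl⟩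
  have hD : (rayNE e n₀ h₀ h).D (n + 1) (3 * n + e + 3) = 1 := if_pos ⟨by omega, by ring⟩
  have hB : (rayNE e n₀ h₀ h).B n (3 * n + e) = 0 := rfl
  rw [hA, hD, hB]
  push_cast
  ring

/-- **Closed form on the south-east ray datum**: `Σ_{ij} ⁅E_{ij}, ⁅E_{ji}, v⁆⁆ = ((e² − 9)∕6) · v` on `raySE e n₀` (`K`-types `V_{n,−(3n+e)}`,
`B_n = −(2n+e+1)∕2`, `C = 1`, `A = D = 0`).  (★ `casimir_raySE_eq_smul`, pointwise, re-derived.) [cite: Kovacevic2021, §3 Thm. 3 (b80), §4] -/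
theorem raySE_sum_lie_lie (e n₀ : ℤ) (h₀ : 1 ≤ n₀) (h : 2 * n₀ ^ 2 + (e - 3) * n₀ + (1 - e) = 0) (v : (raySE e n₀ h₀ h).V) :
    (∑ i : Fin 3, ∑ j : Fin 3, ⁅E i j, ⁅E j i, v⁆⁆) = (((e : ℂ) ^ 2 - 9) / 6) • v := by
  refine sum_lie_lie_eq_smul _ (fun n m hS => ?_) v
  obtain ⟨hn, hm⟩ := hS
  change n₀ ≤ n at hn
  change m = -(3 * n + e) at hm
  subst hm
  have hB : (raySE e n₀ h₀ h).B n (-(3 * n + e)) = -(2 * (n : ℂ) + e + 1) / 2 := if_pos ⟨hn, rfl⟩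
  have hC : (raySE e n₀ h₀ h).C (n + 1) (-(3 * n + e) - 3) = 1 := if_pos ⟨by omega, by ring⟩
  have hA : (raySE e n₀ h₀ h).A n (-(3 * n + e)) = 0 := rfl
  rw [hA, hB, hC]
  push_cast
  ring

/-- The north-east ray has infinitely many `K`-types: `V_{n₀+i, 3(n₀+i)+e}`, `i ∈ ℕ`, are pairwise distinct members of `S`. [cite: Kovacevic2021, §4 Thm. 5 (`Z(s)`, `U(l,2t)`)] -/
theorem rayNE_infinite (e n₀ : ℤ) (h₀ : 1 ≤ n₀) (h : 2 * n₀ ^ 2 + (e - 3) * n₀ + (1 - e) = 0) : (rayNE e n₀ h₀ h).S.Infinite := by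
  refine Set.infinite_of_injective_forall_mem (f := fun i : ℕ => ((n₀ + i : ℤ), 3 * (n₀ + i) + e)) (fun i j hij => ?_) (fun i => ?_)
  · have h1 := congrArg Prod.fst hij
    simp only at h1
    omega
  · change n₀ ≤ n₀ + i ∧ 3 * (n₀ + (i : ℤ)) + e = 3 * (n₀ + i) + e
    exact ⟨by omega, rfl⟩

/-- The south-east ray has infinitely many `K`-types: `V_{n₀+i, −(3(n₀+i)+e)}`, `i ∈ ℕ`. [cite: Kovacevic2021, §4 Thm. 5 (`Z(s)`, `U(l,2t)`)] -/
theorem raySE_infinite (e n₀ : ℤ) (h₀ : 1 ≤ n₀) (h : 2 * n₀ ^ 2 + (e - 3) * n₀ + (1 - e) = 0) : (raySE e n₀ h₀ h).S.Infinite := by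
  refine Set.infinite_of_injective_forall_mem (f := fun i : ℕ => ((n₀ + i : ℤ), -(3 * (n₀ + i) + e))) (fun i j hij => ?_) (fun i => ?_)
  · have h1 := congrArg Prod.fst hij
    simp only at h1
    omega
  · change n₀ ≤ n₀ + i ∧ -(3 * (n₀ + (i : ℤ)) + e) = -(3 * (n₀ + i) + e)
    exact ⟨by omega, rfl⟩

/-! ## §2 The head -/

/-- **PAYMENT OF `sig_K2E1bJDatum`** (socket #11 of unit U2 of the K2_E1b road, `Cruxes/H413/Lines/K2_E1b_GKCohomologyU21_U23_CarriersData.lean`,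
TOKEN FOR TOKEN).  For every `(p,q,t)`, with `(a,b,c) = rogTriple p q t`, `e = a+b+c`, there is an irreducible unitarizable Kovačević datum with infinitely
many `K`-types, integral for the twist by `e` (`6 ∣ m − 3n + 3 + 2e` on its `K`-types), on which `Σ_{ij} E_{ij} E_{ji}` acts by `κ₀(φ) = (a²+b²+c²−2) − e²∕3`.
WITNESS (print's `J^{rogSign p t}_φ|_{SU(2,1)}`, a ladder): with `s = p + t`, the ray ★ `rayNE (2s+1) (−s)` (= `Z(1−s)`) in the `+` case `s ≤ −1`, the ray
★ `raySE (−(2s+1)) (s+1)` (= `Z(−(s+2))`) in the `−` case; irreducible by ★ `isIrreducible_rayNE∕raySE` (`2n + e′ + 1 ≥ 2` along the ray), unitarizable by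
★ `rayNE∕raySE_isUnitarizable` (`2n₀ + e′ + 1 = 2 > 0`, the `n = 1` ∕ `m = 1` unitarity of [R90 p. 178] in Kovačević's coordinates), Casimir `((2s+1)²−9)∕6 =
⅓((a−b)²+(b−c)²+(a−c)²) − 2 = κ₀(φ)` (§1), twist-integral since `e = 3q + 2s + 1`.
[cite: Rogawski1990, §12.3 pp. 176–178] [cite: Kovacevic2021, §3 Thm. 3; §4 Thm. 4–5] [cite: BorelWallach2000, VI Thm. 4.11–4.12] -/
theorem jDatum :
    ∀ (p q t a b c : ℤ), ArchSignRecipe.rogTriple p q t = (a, b, c) →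
      ∃ 𝒬 : SU21Datum, LieModule.IsIrreducible ℂ (Matrix (Fin 3) (Fin 3) ℂ) 𝒬.V ∧ IsUnitarizable 𝒬 ∧ 𝒬.S.Infinite ∧
        (∀ n m : ℤ, (n, m) ∈ 𝒬.S → (6 : ℤ) ∣ m - 3 * n + 3 + 2 * (a + b + c)) ∧
        ∀ v : 𝒬.V, (∑ i : Fin 3, ∑ j : Fin 3, ⁅E i j, ⁅E j i, v⁆⁆) =
          ((((a ^ 2 + b ^ 2 + c ^ 2 - 2 : ℤ) : ℂ)) - (((a + b + c : ℤ) : ℂ)) ^ 2 / 3) • v := by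
  intro p q t a b c hφ
  unfold ArchSignRecipe.rogTriple at hφ
  by_cases hs : p + t ≤ -1
  · -- the `+` case: `(a,b,c) = (q, q+s+1, q+s)`, witness the north-east ladder ray `rayNE (2s+1) (−s)`
    rw [if_pos hs] at hφ
    simp only [Prod.mk.injEq] at hφ
    obtain ⟨rfl, rfl, rfl⟩ := hφ
    have h₀ : (1 : ℤ) ≤ -(p + t) := by omega
    have hrel : 2 * (-(p + t)) ^ 2 + (2 * (p + t) + 1 - 3) * (-(p + t)) + (1 - (2 * (p + t) + 1)) = 0 := by ring
    refine ⟨rayNE (2 * (p + t) + 1) (-(p + t)) h₀ hrel,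
      isIrreducible_rayNE _ _ h₀ hrel (fun n hn => by omega), rayNE_isUnitarizable _ _ h₀ hrel (by omega),
      rayNE_infinite _ _ h₀ hrel, ?_, fun v => ?_⟩
    · rintro n m ⟨-, hm⟩
      change m = 3 * n + (2 * (p + t) + 1) at hm
      subst hm
      exact ⟨q + (p + t) + 1, by ring⟩
    · rw [rayNE_sum_lie_lie]
      congr 1
      push_cast
      ring
  · -- the `−` case: `(a,b,c) = (q+s+1, q+s, q)`, witness the south-east ladder ray `raySE (−(2s+1)) (s+1)`
    rw [if_neg hs] at hφ
    simp only [Prod.mk.injEq] at hφ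
    obtain ⟨rfl, rfl, rfl⟩ := hφ
    have h₀ : (1 : ℤ) ≤ p + t + 1 := by omega
    have hrel : 2 * (p + t + 1) ^ 2 + (-(2 * (p + t) + 1) - 3) * (p + t + 1) + (1 - -(2 * (p + t) + 1)) = 0 := by ring
    refine ⟨raySE (-(2 * (p + t) + 1)) (p + t + 1) h₀ hrel,
      isIrreducible_raySE _ _ h₀ hrel (fun n hn => by omega), raySE_isUnitarizable _ _ h₀ hrel (by omega),
      raySE_infinite _ _ h₀ hrel, ?_, fun v => ?_⟩
    · rintro n m ⟨-, hm⟩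
      change m = -(3 * n + -(2 * (p + t) + 1)) at hm
      subst hm
      exact ⟨q + (p + t) + 1 - n, by ring⟩
    · rw [raySE_sum_lie_lie]
      congr 1
      push_cast
      ring

/-! ## §3 The two cases with the witness named -/

/-- **The `+` case with the witness NAMED**: for `p + t ≤ −1` (`rogSign = +1`, `(a,b,c) = (q, q+p+t+1, q+p+t)`) the ladder ray
`rayNE (2(p+t)+1) (−(p+t))` (`K`-types `V_{n, 3n+2(p+t)+1}`, `n ≥ −(p+t)`; Kovačević's `Z(1−p−t)`) has all five properties of `jDatum`.
[cite: Rogawski1990, §12.3 p. 178] [cite: Kovacevic2021, §4 Thm. 4–5] -/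
theorem jDatum_plus (p q t : ℤ) (hs : p + t ≤ -1) (h₀ : 1 ≤ -(p + t))
    (hrel : 2 * (-(p + t)) ^ 2 + (2 * (p + t) + 1 - 3) * (-(p + t)) + (1 - (2 * (p + t) + 1)) = 0) :
    ArchSignRecipe.rogTriple p q t = (q, q + p + t + 1, q + p + t) ∧
    LieModule.IsIrreducible ℂ (Matrix (Fin 3) (Fin 3) ℂ) (rayNE (2 * (p + t) + 1) (-(p + t)) h₀ hrel).V ∧
      IsUnitarizable (rayNE (2 * (p + t) + 1) (-(p + t)) h₀ hrel) ∧ (rayNE (2 * (p + t) + 1) (-(p + t)) h₀ hrel).S.Infinite ∧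
        (∀ n m : ℤ, (n, m) ∈ (rayNE (2 * (p + t) + 1) (-(p + t)) h₀ hrel).S →
          (6 : ℤ) ∣ m - 3 * n + 3 + 2 * (q + (q + p + t + 1) + (q + p + t))) ∧
        ∀ v : (rayNE (2 * (p + t) + 1) (-(p + t)) h₀ hrel).V, (∑ i : Fin 3, ∑ j : Fin 3, ⁅E i j, ⁅E j i, v⁆⁆) =
          ((((q ^ 2 + (q + p + t + 1) ^ 2 + (q + p + t) ^ 2 - 2 : ℤ) : ℂ)) - (((q + (q + p + t + 1) + (q + p + t) : ℤ) : ℂ)) ^ 2 / 3) • v := by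
  refine ⟨?_, isIrreducible_rayNE _ _ h₀ hrel (fun n hn => by omega), rayNE_isUnitarizable _ _ h₀ hrel (by omega),
    rayNE_infinite _ _ h₀ hrel, ?_, fun v => ?_⟩
  · unfold ArchSignRecipe.rogTriple
    rw [if_pos hs]
  · rintro n m ⟨-, hm⟩
    change m = 3 * n + (2 * (p + t) + 1) at hm
    subst hm
    exact ⟨q + (p + t) + 1, by ring⟩
  · rw [rayNE_sum_lie_lie]
    congr 1
    push_cast
    ring

/-- **The `−` case with the witness NAMED**: for `¬ p + t ≤ −1` (`rogSign = −1`, `(a,b,c) = (q+p+t+1, q+p+t, q)`) the mirror ladder ray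
`raySE (−(2(p+t)+1)) (p+t+1)` (`K`-types `V_{n, −3n+2(p+t)+1}`, `n ≥ p+t+1`; Kovačević's `Z(−(p+t+2))`) has all five properties of `jDatum`.
[cite: Rogawski1990, §12.3 p. 178] [cite: Kovacevic2021, §4 Thm. 4–5] -/
theorem jDatum_minus (p q t : ℤ) (hs : ¬ p + t ≤ -1) (h₀ : 1 ≤ p + t + 1)
    (hrel : 2 * (p + t + 1) ^ 2 + (-(2 * (p + t) + 1) - 3) * (p + t + 1) + (1 - -(2 * (p + t) + 1)) = 0) :
    ArchSignRecipe.rogTriple p q t = (q + p + t + 1, q + p + t, q) ∧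
    LieModule.IsIrreducible ℂ (Matrix (Fin 3) (Fin 3) ℂ) (raySE (-(2 * (p + t) + 1)) (p + t + 1) h₀ hrel).V ∧
      IsUnitarizable (raySE (-(2 * (p + t) + 1)) (p + t + 1) h₀ hrel) ∧ (raySE (-(2 * (p + t) + 1)) (p + t + 1) h₀ hrel).S.Infinite ∧
        (∀ n m : ℤ, (n, m) ∈ (raySE (-(2 * (p + t) + 1)) (p + t + 1) h₀ hrel).S →
          (6 : ℤ) ∣ m - 3 * n + 3 + 2 * ((q + p + t + 1) + (q + p + t) + q)) ∧
        ∀ v : (raySE (-(2 * (p + t) + 1)) (p + t + 1) h₀ hrel).V, (∑ i : Fin 3, ∑ j : Fin 3, ⁅E i j, ⁅E j i, v⁆⁆) =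
          (((((q + p + t + 1) ^ 2 + (q + p + t) ^ 2 + q ^ 2 - 2 : ℤ) : ℂ)) - ((((q + p + t + 1) + (q + p + t) + q : ℤ) : ℂ)) ^ 2 / 3) • v := by
  refine ⟨?_, isIrreducible_raySE _ _ h₀ hrel (fun n hn => by omega), raySE_isUnitarizable _ _ h₀ hrel (by omega),
    raySE_infinite _ _ h₀ hrel, ?_, fun v => ?_⟩
  · unfold ArchSignRecipe.rogTriple
    rw [if_neg hs]
  · rintro n m ⟨-, hm⟩
    change m = -(3 * n + -(2 * (p + t) + 1)) at hm
    subst hm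
    exact ⟨q + (p + t) + 1 - n, by ring⟩
  · rw [raySE_sum_lie_lie]
    congr 1
    push_cast
    ring

end Summit.HodgeConjecture.HodgeConjecture.Cruxes.H413.K2E1bJDatum

end
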